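import Summits.AtomisticToContinuum.BoseEinsteinCondensation.Theorems.BECCutLineWeakDisorderAcrossCutMeanProfileFreeGas
import HarnessLib

/-!
# Route `BECCutLineWeakDisorder`, crux `TwoReplicaTransienceBound` (stmt-AtomisticToContinuum-9687),
# line `across-cut-thinning` (v2): range / junk values of the across-block participation and the
# FREE-GAS calibration row of the module `ParticipationTail`
# (registered toolbox stub `stub_participationTailFreeGas`)

Support file (`--supports stmt-AtomisticToContinuum-9687`; proves the registered TOOLBOX stub
`stub_participationTailFreeGas : Goal.stub_participationTailFreeGas`, NOT the registered module stub
`stub_participationTail : Goal.stub_participationTail` of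
`Theorems/BECCutLineWeakDisorderAcrossCutDefs.lean`, whose interacting content — no heavy tail of the
kinetic-scale across-block participation `R_IR,K` of the insertion profile under the broken-line bridge
slice law `ν₂ ∝ s_Φ(Y)² dY`, uniformly in `n` — hinges on large-deviation (void / emptiness-formation)
estimates for the slice law of the dilute gas at a fixed mesoscopic scale and is open).

* Range and junk values of `acrossPR` (the objects of the junk audit of `ParticipationTail`):
  `acrossPR_of_lintegral_eq_zero` — on a void slice (`∫ g = 0`) `R_IR,K = 0 / 0 = 0`, so the slice
  drops out of BOTH sides of `ParticipationTail`; `acrossPR_le_pow` — `R_IR,K ≤ 8^K` with no side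
  condition (`S_K ≤ (Σ_Q a_Q)² ≤ (∫ g)²`, `x / x ≤ 1`); `one_le_acrossPR` — `1 ≤ R_IR,K` for a slice
  vanishing off `Λ_L` with `0 < ∫ g < ∞` (covering + Cauchy–Schwarz over the `8^K` blocks);
* `acrossPR_const_mul` (private copy of the planner's skeleton lemma,
  `Cruxes/TwoReplicaTransienceBound/Lines/across_cut_thinning.lean`) — `R_IR,K` is scale-free;
* free gas `v ≡ 0`: the insertion slice is the one-line Dirichlet survival profile `θ_T = Z^{(1)}_T`
  times a slice scalar, `Z_{n+1}(x :: Y) = θ_T(x) · Z_n(Y)` (`partSlice_free` of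
  `…AcrossCutMeanProfileFreeGas.lean`), hence `acrossPR_partSlice_free` — `R_IR,K(Y) = R_IR,K(θ_T)`
  is DETERMINISTIC off the null slices `{Z_n(Y) = 0}`, on which `s_Φ(Y) = 0`;
* `participationTail_freeGas_eq` — the reverse-Hölder inequality of `ParticipationTail` is an EQUALITY
  with constant `1` for the free gas, for EVERY `n`, `L`, `T` and EVERY depth `K` (no side conditions:
  both sides equal `((∫ s_Φ²) · R_IR,K(θ_T))⁶`, and vanish together when the profile degenerates);
* `stub_participationTailFreeGas` — the `v := fun _ => 0` instance of `ParticipationTail` with all its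
  other quantifiers verbatim (`ρ₀ = 1`, `C₂ = 1`; `κ`, `ρ < ρ₀`, `∀ᶠ n`, `1 ≤ T` are idle).
-/

noncomputable section

open MeasureTheory Filter Set Finset
open scoped ENNReal NNReal Topology BigOperators

namespace Summit.AtomisticToContinuum.BoseEinsteinCondensation.Cruxes.TwoReplicaTransienceBound.AcrossCutThinning

open Literature.MathematicalPhysics.QuantumManyBody.BoseGas
open Summit.AtomisticToContinuum.BoseEinsteinCondensation.Theses.BECCutLineWeakDisorder
open Summit.AtomisticToContinuum.BoseEinsteinCondensation.Cruxes.TwoReplicaTransienceBound.TracerDecoupling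
  (fkPartition_ne_top)
open Summit.AtomisticToContinuum.BoseEinsteinCondensation.Cruxes.TwoReplicaTransienceBound.TaggedShiftLogHarnack
  (kineticDepth sum_setLIntegral_dyadicCube_le)
open Summit.AtomisticToContinuum.BoseEinsteinCondensation.Cruxes.LandscapeBound.SiblingTelescopingChaining

variable {n : ℕ}

/-! ### Range and junk values of the across-block participation -/

-- adapted from Cruxes/TwoReplicaTransienceBound/Lines/across_cut_thinning.lean (`sq_sum_le_card_mul_sum_sq`)
/-- Cauchy–Schwarz for a finite `ℝ≥0∞`-sum: `(Σ_e a_e)² ≤ #s · Σ_e a_e²`. [folklore] -/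
private theorem sq_sum_le_card_mul_sum_sq {ι : Type*} (s : Finset ι) (a : ι → ℝ≥0∞) :
    (∑ e ∈ s, a e) ^ 2 ≤ (s.card : ℝ≥0∞) * ∑ e ∈ s, a e ^ 2 := by
  have h := ENNReal.rpow_sum_le_const_mul_sum_rpow s a (p := 2) (by norm_num)
  norm_num at h
  simpa [ENNReal.rpow_two] using h

-- adapted from Cruxes/TwoReplicaTransienceBound/Lines/across_cut_thinning.lean (`card_blocks`)
/-- The number of level-`K` blocks is `8^K`. [folklore] -/
private theorem card_blocks (K : ℕ) :
    ((Finset.univ : Finset (Fin 3 → Fin (2 ^ K))).card : ℝ≥0∞) = 8 ^ K := by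
  rw [Finset.card_univ, Fintype.card_fun, Fintype.card_fin, Fintype.card_fin]
  push_cast
  rw [← pow_mul, mul_comm, pow_mul]
  norm_num

/-- `S_K ≤ (∫ g)²` with no side condition (`Σ a_Q² ≤ (Σ a_Q)²`, disjoint blocks). [folklore] -/
theorem levelSq_le_sq_lintegral (g : Space → ℝ≥0∞) (L : ℝ) (K : ℕ) :
    levelSq g L K ≤ (∫⁻ x, g x) ^ 2 := by
  unfold levelSq
  calc ∑ i : Fin 3 → Fin (2 ^ K), blockMass g L K i ^ 2
      ≤ (∑ i : Fin 3 → Fin (2 ^ K), blockMass g L K i) ^ 2 :=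
        Finset.sum_sq_le_sq_sum_of_nonneg fun _ _ => bot_le
    _ ≤ (∫⁻ x, g x) ^ 2 := by
        gcongr
        exact sum_setLIntegral_dyadicCube_le L K g

/-- **Junk value on a void slice**: if `∫ g = 0` then `R_IR,K(g) = 8^K · 0 / 0 = 0` (so in
`ParticipationTail` a slice with `s_Φ(Y) = 0` contributes `0` to both sides). [folklore] -/
theorem acrossPR_of_lintegral_eq_zero {g : Space → ℝ≥0∞} (hg : ∫⁻ x, g x = 0) (L : ℝ) (K : ℕ) :
    acrossPR g L K = 0 := by
  unfold acrossPR
  have hS : levelSq g L K = 0 := le_zero_iff.1 ((levelSq_le_sq_lintegral g L K).trans (by simp [hg]))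
  rw [hS, mul_zero, ENNReal.zero_div]

/-- **Upper range**: `R_IR,K(g) ≤ 8^K` for every `g`, `L`, `K` (junk cases included). [folklore] -/
theorem acrossPR_le_pow (g : Space → ℝ≥0∞) (L : ℝ) (K : ℕ) : acrossPR g L K ≤ 8 ^ K := by
  unfold acrossPR
  calc 8 ^ K * levelSq g L K / (∫⁻ x, g x) ^ 2
      ≤ 8 ^ K * (∫⁻ x, g x) ^ 2 / (∫⁻ x, g x) ^ 2 := by
        gcongr
        exact levelSq_le_sq_lintegral g L K
    _ = 8 ^ K * ((∫⁻ x, g x) ^ 2 / (∫⁻ x, g x) ^ 2) := mul_div_assoc _ _ _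
    _ ≤ 8 ^ K * 1 := mul_le_mul' le_rfl ENNReal.div_self_le_one
    _ = 8 ^ K := mul_one _

/-- **Lower range**: `1 ≤ R_IR,K(g)` for a slice vanishing off `Λ_L` (`L > 0`) with
`0 < ∫ g < ∞` (the blocks cover the box; Cauchy–Schwarz over the `8^K` blocks). [folklore] -/
theorem one_le_acrossPR {g : Space → ℝ≥0∞} {L : ℝ} (hL : 0 < L) (h0 : ∀ x, x ∉ box L → g x = 0)
    (hs0 : ∫⁻ x, g x ≠ 0) (hst : ∫⁻ x, g x ≠ ⊤) (K : ℕ) : 1 ≤ acrossPR g L K := by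
  unfold acrossPR
  rw [ENNReal.le_div_iff_mul_le (Or.inl (pow_ne_zero 2 hs0)) (Or.inl (ENNReal.pow_ne_top hst)),
    one_mul]
  calc (∫⁻ x, g x) ^ 2 ≤ (∑ i : Fin 3 → Fin (2 ^ K), blockMass g L K i) ^ 2 := by
        gcongr
        exact lintegral_le_sum_blockMass hL h0 K
    _ ≤ ((Finset.univ : Finset (Fin 3 → Fin (2 ^ K))).card : ℝ≥0∞) *
          ∑ i : Fin 3 → Fin (2 ^ K), blockMass g L K i ^ 2 := sq_sum_le_card_mul_sum_sq _ _
    _ = 8 ^ K * levelSq g L K := by rw [card_blocks]; rfl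

-- adapted from Cruxes/TwoReplicaTransienceBound/Lines/across_cut_thinning.lean (`acrossPR_const_mul`)
/-- **`R_IR,K` is scale-free**: `acrossPR (c·g) = acrossPR g` for `c ∈ (0, ∞)`. [folklore] -/
private theorem acrossPR_const_mul {c : ℝ≥0∞} (hc0 : c ≠ 0) (hc : c ≠ ⊤) (g : Space → ℝ≥0∞) (L : ℝ)
    (K : ℕ) : acrossPR (fun x => c * g x) L K = acrossPR g L K := by
  unfold acrossPR
  have h1 : ∫⁻ x, c * g x = c * ∫⁻ x, g x := lintegral_const_mul' _ _ hc
  rw [h1, levelSq_const_mul hc, mul_pow, mul_left_comm,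
    ENNReal.mul_div_mul_left _ _ (pow_ne_zero 2 hc0) (ENNReal.pow_ne_top hc)]

/-! ### The free insertion slice -/

/-- Free gas, function form of `partSlice_free`: the insertion slice is the slice scalar `Z_n(Y)`
times the one-line Dirichlet survival profile `θ_T = Z^{(1)}_T`. [folklore] -/
theorem partSlice_free_eq_const_mul (L T : ℝ) (Y : Config n) :
    partSlice (fun _ => 0) L T Y =
      fun x => fkPartition (fun _ => 0) L T Y * fkPartition (N := 1) (fun _ => 0) L T (fun _ => x) :=
  funext fun x => (partSlice_free L T Y x).trans (mul_comm _ _)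

/-- The free slice mass: `s_Φ(Y) = Z_n(Y) · ∫ θ_T`. [folklore] -/
theorem lintegral_partSlice_free (L T : ℝ) (Y : Config n) :
    ∫⁻ x, partSlice (fun _ => 0) L T Y x =
      fkPartition (fun _ => 0) L T Y * ∫⁻ x, fkPartition (N := 1) (fun _ => 0) L T (fun _ => x) := by
  rw [partSlice_free_eq_const_mul]
  exact lintegral_const_mul' _ _ (fkPartition_ne_top _ L T Y)

/-- `Y ↦ s_Φ(Y)²` is measurable (free gas). [folklore] -/
theorem measurable_sq_lintegral_partSlice_free (L T : ℝ) :
    Measurable fun Y : Config n => (∫⁻ x, partSlice (fun _ => 0) L T Y x) ^ 2 := by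
  simp_rw [lintegral_partSlice_free]
  exact ((measurable_fkPartition_bath measurable_const L T).mul measurable_const).pow_const 2

/-- **Off the null slices the free across-block participation is deterministic**:
`R_IR,K(Z_{n+1}(· :: Y)) = R_IR,K(θ_T)` whenever `Z_n(Y) ≠ 0`. [folklore] -/
theorem acrossPR_partSlice_free (L T : ℝ) (K : ℕ) {Y : Config n}
    (hY : fkPartition (fun _ => 0) L T Y ≠ 0) :
    acrossPR (partSlice (fun _ => 0) L T Y) L K =
      acrossPR (fun x => fkPartition (N := 1) (fun _ => 0) L T (fun _ => x)) L K := by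
  rw [partSlice_free_eq_const_mul]
  exact acrossPR_const_mul hY (fkPartition_ne_top _ L T Y) _ L K

/-- Pointwise: `s_Φ(Y)² · R_IR,K(Y)^m = s_Φ(Y)² · R_IR,K(θ_T)^m` for every slice (on the null slices
`Z_n(Y) = 0` both sides vanish: `s_Φ(Y) = 0`). [folklore] -/
theorem sq_mul_acrossPR_pow_free (L T : ℝ) (K m : ℕ) (Y : Config n) :
    (∫⁻ x, partSlice (fun _ => 0) L T Y x) ^ 2 * acrossPR (partSlice (fun _ => 0) L T Y) L K ^ m =
      (∫⁻ x, partSlice (fun _ => 0) L T Y x) ^ 2 *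
        acrossPR (fun x => fkPartition (N := 1) (fun _ => 0) L T (fun _ => x)) L K ^ m := by
  rcases eq_or_ne (fkPartition (fun _ => 0) L T Y) 0 with hY | hY
  · rw [lintegral_partSlice_free, hY, zero_mul, zero_pow two_ne_zero, zero_mul, zero_mul]
  · rw [acrossPR_partSlice_free L T K hY]

/-! ### The free-gas row: equality with constant one -/

/-- **`ParticipationTail` for the FREE gas is an equality with `C₂ = 1`**, for every `n`, `L`, `T`
and every depth `K`: with `s(Y) = s_Φ(Y)`, `R(Y) = R_IR,K(Z_{n+1}(· :: Y))` and the deterministic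
`R₀ = R_IR,K(θ_T)`, both `(∫ s²)⁵ · ∫ s² R⁶` and `(∫ s² R)⁶` equal `((∫ s²) R₀)⁶`
(`sq_mul_acrossPR_pow_free`; Hölder's inequality is an equality for a `ν₂`-a.s. constant). [folklore] -/
theorem participationTail_freeGas_eq (n : ℕ) (L T : ℝ) (K : ℕ) :
    (∫⁻ Y : Config n, (∫⁻ x, partSlice (fun _ => 0) L T Y x) ^ 2) ^ 5 *
        ∫⁻ Y : Config n, (∫⁻ x, partSlice (fun _ => 0) L T Y x) ^ 2 *
          acrossPR (partSlice (fun _ => 0) L T Y) L K ^ 6 =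
      (∫⁻ Y : Config n, (∫⁻ x, partSlice (fun _ => 0) L T Y x) ^ 2 *
          acrossPR (partSlice (fun _ => 0) L T Y) L K) ^ 6 := by
  have h1 : ∀ Y : Config n, (∫⁻ x, partSlice (fun _ => 0) L T Y x) ^ 2 *
      acrossPR (partSlice (fun _ => 0) L T Y) L K =
      (∫⁻ x, partSlice (fun _ => 0) L T Y x) ^ 2 *
        acrossPR (fun x => fkPartition (N := 1) (fun _ => 0) L T (fun _ => x)) L K := fun Y => by
    simpa only [pow_one] using sq_mul_acrossPR_pow_free L T K 1 Y
  simp_rw [sq_mul_acrossPR_pow_free L T K 6, h1]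
  rw [lintegral_mul_const _ (measurable_sq_lintegral_partSlice_free L T),
    lintegral_mul_const _ (measurable_sq_lintegral_partSlice_free L T), mul_pow, ← mul_assoc,
    ← pow_succ]

/-! ### The registered toolbox stub -/

namespace Goal

/-- Registered toolbox stub `stub_participationTailFreeGas`: the body of `ParticipationTail` with
`v := fun _ => 0` (every other quantifier verbatim). -/
abbrev stub_participationTailFreeGas : Prop :=
  ∀ κ : ℝ, 0 < κ → ∃ ρ₀ : ℝ, 0 < ρ₀ ∧
    ∀ ρ : ℝ, 0 < ρ → ρ < ρ₀ → ∃ C₂ : ℝ, 0 < C₂ ∧ ∀ᶠ n : ℕ in atTop, ∀ T : ℝ, 1 ≤ T →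
      (∫⁻ Y : Config n, (∫⁻ x, partSlice (fun _ => 0) (sideLength ρ (n + 1)) T Y x) ^ 2) ^ 5 *
          ∫⁻ Y : Config n, (∫⁻ x, partSlice (fun _ => 0) (sideLength ρ (n + 1)) T Y x) ^ 2 *
            acrossPR (partSlice (fun _ => 0) (sideLength ρ (n + 1)) T Y) (sideLength ρ (n + 1))
              (kineticDepth κ ρ (sideLength ρ (n + 1))) ^ 6 ≤
        ENNReal.ofReal C₂ *
          (∫⁻ Y : Config n, (∫⁻ x, partSlice (fun _ => 0) (sideLength ρ (n + 1)) T Y x) ^ 2 *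
            acrossPR (partSlice (fun _ => 0) (sideLength ρ (n + 1)) T Y) (sideLength ρ (n + 1))
              (kineticDepth κ ρ (sideLength ρ (n + 1)))) ^ 6

end Goal

/-- **PROVED toolbox stub `stub_participationTailFreeGas`** — the free-gas row of the module
`ParticipationTail`: for `v ≡ 0` the reverse-Hölder bound holds with `C₂ = 1` (in fact with equality,
`participationTail_freeGas_eq`), for every `κ > 0`, every `ρ` (`ρ₀ = 1` is idle), every `n` and every
`T`. [folklore] -/
theorem stub_participationTailFreeGas : Goal.stub_participationTailFreeGas := by
  intro κ _
  refine ⟨1, one_pos, fun ρ _ _ => ⟨1, one_pos, Eventually.of_forall fun n T _ => ?_⟩⟩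
  rw [ENNReal.ofReal_one, one_mul, participationTail_freeGas_eq]

end Summit.AtomisticToContinuum.BoseEinsteinCondensation.Cruxes.TwoReplicaTransienceBound.AcrossCutThinning

end
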